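import Summits.QuantumFields.YangMills.Theses.RenyiTelescope

/-!
# Route `RenyiTelescope` — crux `FineRegimeUnitTailL` (stmt-QuantumFields-27138), registered stub `stub_chernoffUnitPlaquette` (M), PROVED

The BC3 birth skeleton of crux `FineRegimeUnitTailL` (LINE 6 of ideator seat ym-r3-idea-2 g3; registered on stmt-QuantumFields-27138)
composes the crux from `stub_fineExpMoment` (XL, the analytic content: a Gaussian-scale exponential moment of the unit plaquette under the
interior-conditioned Gibbs law in the semiclassical regime — NOT touched here) and `stub_chernoffUnitPlaquette` (M).  THIS FILE proves the
latter EXACTLY AS REGISTERED: for the Gibbs law `μ = gibbsK F ℰp γ J` (`γ > 0`, a probability measure), a measurable set `S`, `s, θ ≥ 0` and the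
unit-plaquette observable `X U = dist1((unitA U)(∂p))`, integrability of `exp(s·X²)` on `S` gives

  `μ( unitA⁻¹{θ ≤ dist1(V(∂p))} ∩ S ) ≤ exp(−s·θ²) · ∫_S exp(s·X²) dμ`.

PROOF.  Markov's inequality (Mathlib `mul_meas_ge_le_integral_of_nonneg`) for the non-negative integrable function `exp(s·X²)` under the
restricted measure `μ|S` at level `exp(s·θ²)`, the inclusion `{θ ≤ X} ⊆ {exp(sθ²) ≤ exp(sX²)}` (`θ ≥ 0`, `s ≥ 0`), and `(μ|S)(E) = μ(E ∩ S)` for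
measurable `S` (`Measure.restrict_apply'`, no measurability of `E` needed).

HONEST SCOPE.  `stub_fineExpMoment`, the crux `FineRegimeUnitTailL`, the route and rung R3 (leaf `YM3TorusSU2`) stay open; nothing here bears on
the Yang–Mills mass gap.  [folklore: exponential Chebyshev inequality]
-/

noncomputable section

open MeasureTheory
open Literature.MathematicalPhysics.QuantumFieldTheory.Balaban1983to89
open Literature.MathematicalPhysics.QuantumFieldTheory.Balaban1983to89.T3ContinuumYM3Torus

namespace Summit.QuantumFields.YangMills.Theorems.RenyiTelescope

/-- Markov step in the abstract: a finite measure `ν`, a non-negative `ν`-integrable `f`, a level `ε > 0` and an event `E ⊆ {ε ≤ f}` give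
`ν(E) ≤ ε⁻¹ · ∫ f dν`. [folklore] -/
theorem measureReal_le_inv_mul_integral {Ω : Type*} [MeasurableSpace Ω] (ν : Measure Ω) [IsFiniteMeasure ν] {f : Ω → ℝ}
    (hf0 : ∀ ω, 0 ≤ f ω) (hfi : Integrable f ν) {ε : ℝ} (hε : 0 < ε) {E : Set Ω} (hE : E ⊆ {ω | ε ≤ f ω}) :
    ν.real E ≤ ε⁻¹ * ∫ ω, f ω ∂ν := by
  have hmk : ε * ν.real {ω | ε ≤ f ω} ≤ ∫ ω, f ω ∂ν :=
    mul_meas_ge_le_integral_of_nonneg (Filter.Eventually.of_forall hf0) hfi ε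
  have hmono : ν.real E ≤ ν.real {ω | ε ≤ f ω} := measureReal_mono hE
  rw [le_inv_mul_iff₀ hε]
  exact (mul_le_mul_of_nonneg_left hmono hε.le).trans hmk

/-- **STUB `stub_chernoffUnitPlaquette` of crux `FineRegimeUnitTailL` (stmt-QuantumFields-27138), exactly as registered** — the exponential
Chebyshev inequality for the unit-plaquette threshold event inside a measurable set. [folklore] -/
theorem stub_chernoffUnitPlaquette : open Literature.MathematicalPhysics.QuantumFieldTheory.Balaban1983to89 Literature.MathematicalPhysics.QuantumFieldTheory.Balaban1983to89.T3ContinuumYM3Torus in ∀ (F : T3Family) (γ : ℝ) (J : ℕ) (p : Plaq (F.P 0) 0)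
      (S : Set (GaugeField (F.P J) 0 (Matrix.specialUnitaryGroup (Fin 2) ℂ))) (s θ : ℝ), 0 < γ → 0 ≤ s → 0 ≤ θ → MeasurableSet S →
      MeasureTheory.Integrable (fun U => Real.exp (s * (GaugeGroup.dist1 (GaugeField.plaqHol (T3UnitScaleTilt.unitA F T3UnitLawDensityEML.ℰp J U) p)) ^ 2)) ((T3UnitScaleTilt.gibbsK F T3UnitLawDensityEML.ℰp γ J).restrict S) →
      (T3UnitScaleTilt.gibbsK F T3UnitLawDensityEML.ℰp γ J).real ((T3UnitScaleTilt.unitA F T3UnitLawDensityEML.ℰp J) ⁻¹' {V | θ ≤ GaugeGroup.dist1 (GaugeField.plaqHol V p)} ∩ S) ≤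
        Real.exp (-(s * θ ^ 2)) * ∫ U in S, Real.exp (s * (GaugeGroup.dist1 (GaugeField.plaqHol (T3UnitScaleTilt.unitA F T3UnitLawDensityEML.ℰp J U) p)) ^ 2) ∂(T3UnitScaleTilt.gibbsK F T3UnitLawDensityEML.ℰp γ J) := by
  intro F γ J p S s θ hγ hs hθ hS hint
  haveI := T3UnitScaleTilt.isProbabilityMeasure_gibbsK F T3UnitLawDensityEML.ℰp hγ.le J
  set μ := T3UnitScaleTilt.gibbsK F T3UnitLawDensityEML.ℰp γ J with hμ
  set f : GaugeField (F.P J) 0 (Matrix.specialUnitaryGroup (Fin 2) ℂ) → ℝ :=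
    fun U => Real.exp (s * (GaugeGroup.dist1 (GaugeField.plaqHol (T3UnitScaleTilt.unitA F T3UnitLawDensityEML.ℰp J U) p)) ^ 2) with hf
  have hε : 0 < Real.exp (s * θ ^ 2) := Real.exp_pos _
  have hsub : ((T3UnitScaleTilt.unitA F T3UnitLawDensityEML.ℰp J) ⁻¹' {V | θ ≤ GaugeGroup.dist1 (GaugeField.plaqHol V p)} ∩ S)
      ⊆ {U | Real.exp (s * θ ^ 2) ≤ f U} := by
    intro U hU
    have hU1 : θ ≤ GaugeGroup.dist1 (GaugeField.plaqHol (T3UnitScaleTilt.unitA F T3UnitLawDensityEML.ℰp J U) p) := hU.1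
    show Real.exp (s * θ ^ 2) ≤ Real.exp (s * (GaugeGroup.dist1 (GaugeField.plaqHol (T3UnitScaleTilt.unitA F T3UnitLawDensityEML.ℰp J U) p)) ^ 2)
    exact Real.exp_le_exp.mpr (mul_le_mul_of_nonneg_left (pow_le_pow_left₀ hθ hU1 2) hs)
  have hrestr : μ.real ((T3UnitScaleTilt.unitA F T3UnitLawDensityEML.ℰp J) ⁻¹' {V | θ ≤ GaugeGroup.dist1 (GaugeField.plaqHol V p)} ∩ S)
      = (μ.restrict S).real ((T3UnitScaleTilt.unitA F T3UnitLawDensityEML.ℰp J) ⁻¹' {V | θ ≤ GaugeGroup.dist1 (GaugeField.plaqHol V p)} ∩ S) := by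
    simp only [Measure.real, Measure.restrict_apply' hS, Set.inter_assoc, Set.inter_self]
  rw [hrestr]
  have hmain := measureReal_le_inv_mul_integral (μ.restrict S) (f := f) (fun U => (Real.exp_pos _).le) hint hε hsub
  rw [← Real.exp_neg] at hmain
  exact hmain

end Summit.QuantumFields.YangMills.Theorems.RenyiTelescope

end
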